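import Literature.NumberTheory.Transcendental.FormIntegrationPullbackCharts
import Literature.NumberTheory.Transcendental.FormIntegrationPUProofs
import Literature.Geometry.Kaehler.ManifoldFormsPullback
import HarnessLib

/-!
# Diffeomorphism invariance of `∫_M` and independence of the partition of unity (discharged)

Topic: integration of top-degree forms on compact oriented manifolds (Warner (1983), §4.8;
Lee (2013), Ch. 16). This file discharges the named fact
`Literature.Geometry.Kaehler.MForm.integral_pullback` of
`Literature/NumberTheory/Transcendental/FormIntegration.lean` — **diffeomorphism invariance of the
integral**: for an orientation-preserving `C^∞` diffeomorphism `f : M → N` onto a compact manifold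
with a continuous orientation family `o'` and a smooth top form `β` on `N`, `∫_M f^*β = ∫_N β`
(Warner (1983), 4.8 eq. (5); Lee (2013), Prop. 16.6(d)).

It follows from `integralPU_pullback_eq_integralPU`: for `f`, `β` as above and *any* two smooth
partitions of unity, `ρ` on `M` subordinate to the sources of the charts at `c i` and `ρ'` on `N`
subordinate to the sources of the charts at `c' j`, `(f^*β).integralPU ρ o c = β.integralPU ρ' o' c'`
(for `f = id` this recovers the independence of the partition of unity,
`Literature.Geometry.Kaehler.MForm.integralPU_eq_integral_holds` of `FormIntegrationPUProofs.lean`).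
Boundary and corners are allowed throughout.

## Proof architecture (Warner (1983), 4.8 (2)–(4))

Only finitely many `ρ i`, `ρ' j` are not identically zero (compactness). Inserting
`1 = ∑ⱼ ρ' j ∘ f` on `M` and `1 = ∑ᵢ ρ i ∘ f⁻¹` on `N` (finite sums, exchanged with the chart
integrals by integrability of the chart integrands,
`integrableOn_chartIntegrand_of_tsupport_subset` of `FormIntegrationPUProofs.lean`) writes both sides as double sums over `(i, j)` of chart integrals with the weight
`g i j = (ρ i ∘ f⁻¹) · ρ' j`, supported in `f '' (source of the chart at c i) ∩ (source of the
chart at c' j)`; the `(i, j)` terms agree by the single-pair change of variables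
`setIntegral_chartIntegrand_pullback_eq` of `FormIntegrationPullbackCharts.lean`. The continuity
of the orientation family of `M` and the smoothness of `f^*β`, needed for integrability on the
`M` side, are `isContinuousOrientation_of_orientationMap` (of `FormIntegrationPullbackCharts.lean`)
and `isSmoothForm_pullback` (unconditional through the instance `instPullbackFacts` of
`Literature/Geometry/Kaehler/ManifoldFormsPullback.lean`).

## References

* F. W. Warner, *Foundations of Differentiable Manifolds and Lie Groups*, GTM 94, Springer
  (1983), 4.8 Integration on an oriented manifold, eqs. (1)–(5) (PDF pp. 145–147).
* J. M. Lee, *Introduction to Smooth Manifolds*, 2nd ed., GTM 218, Springer (2013),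
  Prop. 16.5 (p. 405), Prop. 16.6 (p. 406).
-/

noncomputable section

open scoped Manifold ContDiff Topology
open Bundle Set Module MeasureTheory Function Filter

namespace Literature.NumberTheory.Transcendental

/-! ### The double partition of unity argument -/

section TwoPartitions

variable {E : Type*} [NormedAddCommGroup E] [NormedSpace ℝ E] [FiniteDimensional ℝ E]
  {n : ℕ} [Fact (finrank ℝ E = n)] [MeasurableSpace E] [BorelSpace E]
  {H : Type*} [TopologicalSpace H] {I : ModelWithCorners ℝ E H}
  {M : Type*} [TopologicalSpace M] [ChartedSpace H M] [IsManifold I ∞ M] [CompactSpace M]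
  {E' : Type*} [NormedAddCommGroup E'] [NormedSpace ℝ E'] [FiniteDimensional ℝ E']
  [Fact (finrank ℝ E' = n)] [MeasurableSpace E'] [BorelSpace E']
  {H' : Type*} [TopologicalSpace H'] {I' : ModelWithCorners ℝ E' H'}
  {N : Type*} [TopologicalSpace N] [ChartedSpace H' N] [IsManifold I' ∞ N] [CompactSpace N]
  (o : (x : M) → Orientation ℝ (TangentSpace I x) (Fin n))
  (o' : (x : N) → Orientation ℝ (TangentSpace I' x) (Fin n))

omit [FiniteDimensional ℝ E] [Fact (finrank ℝ E = n)] [MeasurableSpace E] [BorelSpace E]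
  [IsManifold I ∞ M] [CompactSpace M] in
/-- Summing a smooth partition of unity over any finset containing the indices of the functions
that are not identically zero gives `1`. [folklore] -/
theorem sum_eq_one_of_support_subset {ι : Type*} {s : Set M} (ρ : SmoothPartitionOfUnity ι I M s)
    (S : Finset ι) (hS : ∀ i, i ∉ S → ∀ x, ρ i x = 0) {x : M} (hx : x ∈ s) :
    ∑ i ∈ S, ρ i x = 1 := by
  have hsub : support (fun i ↦ ρ i x) ⊆ (S : Set ι) := by
    intro i hi
    simp only [Finset.mem_coe]
    by_contra h
    exact hi (hS i h x)
  exact (finsum_eq_sum_of_support_subset _ hsub).symm.trans (ρ.sum_eq_one hx)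

/-- **Warner's double partition of unity identity** (Warner (1983), 4.8, eqs. (2)–(4), with a
diffeomorphism inserted). Let `f : M → N` be a `C^∞` diffeomorphism of compact manifolds which is
orientation-compatible (`Df(x)` underlies a linear isomorphism `L` with `L_* (o x) = o' (f x)`),
`o'` a continuous orientation family on `N` and `β` a smooth top form on `N`. Then for ANY smooth
partition of unity `ρ` on `M` subordinate to the sources of the charts at `c i` and ANY smooth
partition of unity `ρ'` on `N` subordinate to the sources of the charts at `c' j`, the integral
of `f^*β` computed with `ρ` equals the integral of `β` computed with `ρ'`:
`(f^*β).integralPU ρ o c = β.integralPU ρ' o' c'`. [cite: Warner1983, 4.8(4)] -/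
theorem integralPU_pullback_eq_integralPU (ho' : IsContinuousOrientation o')
    (f : M ≃ₘ^(∞ : WithTop ℕ∞)⟮I, I'⟯ N)
    (hcompat : ∀ x, ∃ L : TangentSpace I x ≃ₗ[ℝ] TangentSpace I' (f x),
      (∀ v, L v = mfderiv I I' f x v) ∧ Orientation.map (Fin n) L (o x) = o' (f x))
    {β : Literature.Geometry.Kaehler.MForm I' N ℝ n} (hβ : Literature.Geometry.Kaehler.IsSmoothForm β)
    {ι : Type*} (ρ : SmoothPartitionOfUnity ι I M univ) (c : ι → M)
    (hρ : ρ.IsSubordinate fun i ↦ (chartAt H (c i)).source)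
    {ι' : Type*} (ρ' : SmoothPartitionOfUnity ι' I' N univ) (c' : ι' → N)
    (hρ' : ρ'.IsSubordinate fun j ↦ (chartAt H' (c' j)).source) :
    (β.pullback I f).integralPU ρ o c = β.integralPU ρ' o' c' := by
  have hfC : ContMDiff I I' ∞ f := f.contMDiff
  have hfD : MDifferentiable I I' f := f.mdifferentiable (by simp)
  have ho : IsContinuousOrientation o :=
    isContinuousOrientation_of_orientationMap o o' ho' hfC hcompat
  have hβf : Literature.Geometry.Kaehler.IsSmoothForm (β.pullback I f) :=
    isSmoothForm_pullback hfC hβ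
  -- finite index sets
  have hfin : {i | (support (ρ i)).Nonempty}.Finite := ρ.locallyFinite.finite_nonempty_of_compact
  have hfin' : {j | (support (ρ' j)).Nonempty}.Finite :=
    ρ'.locallyFinite.finite_nonempty_of_compact
  set S := hfin.toFinset with hS
  set S' := hfin'.toFinset with hS'
  have hSmem : ∀ i, i ∉ S → ∀ x, ρ i x = 0 := by
    intro i hi x
    by_contra hx
    exact hi (hfin.mem_toFinset.2 ⟨x, hx⟩)
  have hS'mem : ∀ j, j ∉ S' → ∀ z, ρ' j z = 0 := by
    intro j hj z
    by_contra hz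
    exact hj (hfin'.mem_toFinset.2 ⟨z, hz⟩)
  have hsum : ∀ x : M, ∑ i ∈ S, ρ i x = 1 := fun x ↦
    sum_eq_one_of_support_subset ρ S hSmem (mem_univ x)
  have hsum' : ∀ z : N, ∑ j ∈ S', ρ' j z = 1 := fun z ↦
    sum_eq_one_of_support_subset ρ' S' hS'mem (mem_univ z)
  -- the cross weights `g i j = (ρ i ∘ f⁻¹) · ρ' j` on `N`
  set g : ι → ι' → N → ℝ := fun i j z ↦ ρ i (f.symm z) * ρ' j z with hg
  have hg_cont : ∀ i j, Continuous (g i j) := fun i j ↦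
    ((map_continuous (ρ i)).comp f.symm.continuous).mul (map_continuous (ρ' j))
  have hgf : ∀ i j x, g i j (f x) = ρ i x * ρ' j (f x) := by
    intro i j x
    simp only [hg, Diffeomorph.symm_apply_apply]
  have hgsupp : ∀ i j z, g i j z ≠ 0 →
      z ∈ (extChartAt I' (c' j)).source ∧ ∃ x ∈ (extChartAt I (c i)).source, f x = z := by
    intro i j z hz
    have h1 : ρ i (f.symm z) ≠ 0 := left_ne_zero_of_mul hz
    have h2 : ρ' j z ≠ 0 := right_ne_zero_of_mul hz
    refine ⟨?_, f.symm z, ?_, f.apply_symm_apply z⟩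
    · rw [extChartAt_source]
      exact hρ' j (subset_tsupport _ h2)
    · rw [extChartAt_source]
      exact hρ i (subset_tsupport _ h1)
  -- the `(i, j)` chart integrals agree (change of variables for one pair of charts)
  have hTT' : ∀ i j,
      ∫ y in (extChartAt I (c i)).target, chartSign o (c i) y *
          g i j (f ((extChartAt I (c i)).symm y)) *
            (β.pullback I f).inChart (c i) y (modelBasis E n) ∂(modelBasis E n).addHaar =
      ∫ y in (extChartAt I' (c' j)).target, chartSign o' (c' j) y *
          g i j ((extChartAt I' (c' j)).symm y) *
            β.inChart (c' j) y (modelBasis E' n) ∂(modelBasis E' n).addHaar := fun i j ↦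
    setIntegral_chartIntegrand_pullback_eq o o' hfD f.toEquiv.injective hcompat (c i) (c' j)
      (hgsupp i j) β
  -- integrability of the `(i, j)` chart integrands
  have hint : ∀ i j, IntegrableOn (fun y ↦ chartSign o (c i) y *
      g i j (f ((extChartAt I (c i)).symm y)) * (β.pullback I f).inChart (c i) y (modelBasis E n))
      (extChartAt I (c i)).target (modelBasis E n).addHaar := by
    intro i j
    have hgf' : (fun x ↦ g i j (f x)) = fun x ↦ ρ i x * ρ' j (f x) := funext (hgf i j)
    have hts : tsupport (fun x ↦ g i j (f x)) ⊆ (extChartAt I (c i)).source := by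
      rw [hgf', extChartAt_source]
      exact (tsupport_mul_subset_left).trans (hρ i)
    exact integrableOn_chartIntegrand_of_tsupport_subset ho hβf (f := fun x ↦ g i j (f x))
      ((hg_cont i j).comp f.continuous) hts
  have hint' : ∀ i j, IntegrableOn (fun y ↦ chartSign o' (c' j) y *
      g i j ((extChartAt I' (c' j)).symm y) * β.inChart (c' j) y (modelBasis E' n))
      (extChartAt I' (c' j)).target (modelBasis E' n).addHaar := by
    intro i j
    have hts : tsupport (g i j) ⊆ (extChartAt I' (c' j)).source := by
      rw [extChartAt_source]
      exact (tsupport_mul_subset_right).trans (hρ' j)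
    exact integrableOn_chartIntegrand_of_tsupport_subset ho' hβ (hg_cont i j) hts
  -- the `M` side as a double sum
  have hM : (β.pullback I f).integralPU ρ o c = ∑ i ∈ S, ∑ j ∈ S',
      ∫ y in (extChartAt I (c i)).target, chartSign o (c i) y *
          g i j (f ((extChartAt I (c i)).symm y)) *
            (β.pullback I f).inChart (c i) y (modelBasis E n) ∂(modelBasis E n).addHaar := by
    rw [Literature.Geometry.Kaehler.MForm.integralPU, finsum_eq_sum_of_support_subset _ (s := S)]
    · refine Finset.sum_congr rfl fun i _ ↦ ?_
      rw [← integral_finsetSum S' (fun j _ ↦ hint i j)]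
      refine setIntegral_congr_fun (measurableSet_extChartAt_target (c i)) fun y _ ↦ ?_
      simp only [hgf]
      rw [← Finset.sum_mul, ← Finset.mul_sum, ← Finset.mul_sum, hsum', mul_one]
    · intro i hi
      simp only [Finset.mem_coe]
      by_contra h
      apply hi
      simp only [hSmem i h, mul_zero, zero_mul, integral_zero]
  -- the `N` side as a double sum
  have hN : β.integralPU ρ' o' c' = ∑ j ∈ S', ∑ i ∈ S,
      ∫ y in (extChartAt I' (c' j)).target, chartSign o' (c' j) y *
          g i j ((extChartAt I' (c' j)).symm y) *
            β.inChart (c' j) y (modelBasis E' n) ∂(modelBasis E' n).addHaar := by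
    rw [Literature.Geometry.Kaehler.MForm.integralPU, finsum_eq_sum_of_support_subset _ (s := S')]
    · refine Finset.sum_congr rfl fun j _ ↦ ?_
      rw [← integral_finsetSum S (fun i _ ↦ hint' i j)]
      refine setIntegral_congr_fun (measurableSet_extChartAt_target (c' j)) fun y _ ↦ ?_
      simp only [hg]
      rw [← Finset.sum_mul, ← Finset.mul_sum, ← Finset.sum_mul, hsum, one_mul]
    · intro j hj
      simp only [Finset.mem_coe]
      by_contra h
      apply hj
      simp only [hS'mem j h, mul_zero, zero_mul, integral_zero]
  rw [hM, hN, Finset.sum_comm]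
  exact Finset.sum_congr rfl fun j _ ↦ Finset.sum_congr rfl fun i _ ↦ hTT' i j

end TwoPartitions

/-! ### The named fact -/

section Facts

variable {E : Type*} [NormedAddCommGroup E] [NormedSpace ℝ E] [FiniteDimensional ℝ E]
  {n : ℕ} [Fact (finrank ℝ E = n)] [MeasurableSpace E] [BorelSpace E]
  {H : Type*} [TopologicalSpace H] {I : ModelWithCorners ℝ E H}
  {M : Type*} [TopologicalSpace M] [ChartedSpace H M] [T2Space M] [SigmaCompactSpace M]
  [IsManifold I ∞ M]
  (o : (x : M) → Orientation ℝ (TangentSpace I x) (Fin n))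

/-- **Diffeomorphism invariance of the integral** — discharge of the named fact
`Literature.Geometry.Kaehler.MForm.integral_pullback`: if `f : M → N` is an orientation-preserving
`C^∞` diffeomorphism onto a compact manifold `N` with a continuous orientation family `o'`
(`Orientation.map (Df_x) (o x) = o' (f x)` for all `x`) and `β` is a smooth top form on `N`, then
`∫_M f^*β = ∫_N β`. Warner (1983), 4.8, eq. (5) (`∫_{γ(D)} ω = ± ∫_D δγ(ω)`, with `+` iff `γ`
preserves orientations; here between two manifolds, as in Lee (2013), Prop. 16.6(d)). Proof:
`M` is compact (homeomorphic to `N`), and `integralPU_pullback_eq_integralPU` applied to the two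
chosen partitions of unity `chartPartitionOfUnity I M` and `chartPartitionOfUnity I' N` defining
`∫_M` and `∫_N`. [cite: Warner1983, 4.8(5)] -/
theorem _root_.Literature.Geometry.Kaehler.MForm.integral_pullback_holds :
    Literature.Geometry.Kaehler.MForm.integral_pullback o := by
  intro E' _ _ _ _ _ _ H' _ I' N _ _ _ _ _ o' ho' f hf β hβ
  haveI : CompactSpace M := f.toHomeomorph.symm.compactSpace
  exact integralPU_pullback_eq_integralPU o o' ho' f
    (fun x ↦ ⟨(f.mfderivToContinuousLinearEquiv (by simp) x).toLinearEquiv, fun _ ↦ rfl, hf x⟩)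
    hβ (chartPartitionOfUnity I M) id chartPartitionOfUnity_isSubordinate
    (chartPartitionOfUnity I' N) id chartPartitionOfUnity_isSubordinate

end Facts

end Literature.NumberTheory.Transcendental
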